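import Summits.CriticalPhenomena.PercolationContinuityZ3.Theorems.PercAnnulusCrossingSetToSetHighDim
import Literature.Barriers.CriticalPhenomena.LaceExpansionEtaZeroXSpaceEventually
import HarnessLib

/-!
# RSW3 lane (lead, gen 13): (A2)□ fails at `p_c(ℤ^d)` in high dimensions AT EVERY ASPECT, and UNCONDITIONALLY for all
# sufficiently large `d`

builds on p205010 (kernel theorem, internal audit signed; external expert review pending) — NOT used in this file.

Cell `prim-rsw3` (LANE 3), lead seat, gen 13.  Support file (`--supports stmt-CriticalPhenomena-4575`); no definitions, no named facts of
its own, no sorries.  Companion of `PercAnnulusCrossingSetToSetHighDim.lean` (V149: `¬ SetToSetQuasiMultAt d p_c ϰ` for `d > 6` under (t-c) with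
`η = 0`).  Two additions.

(1) GENERAL ASPECT.  Basu–Sapozhnikov's hypothesis at aspect `(s, L)` — inner box `Λ(m)`, middle sphere `∂ⁱⁿΛ(sm)`, outer box `Λ(Lm)`
(`Crossing.SetToSetQuasiMultAspectAt d p s L ϰ`; the printed (A2) is `(2,4)`, p1's LANE-4 theorems consume general `(s, L)`) — FAILS at
`p_c(ℤ^d)` for EVERY `s ≥ 1`, EVERY `L` and every `ϰ > 0` as soon as `8 < d` and `TwoPointBoundedRatio d`
(`not_setToSetQuasiMultAspectAt_criticalProbI_of_twoPointBoundedRatio`).  The argument is the all-polynomial variant of V149 and needs NO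
annulus-crossing input: with `n = (L+s)M`, apply (A2)□ at the origin (scale `M`, `X = {0}`, `Y = {y}`, `‖y‖_∞ = n+1`) and centred at `y`
(scale `M`, `X' = {y}`, `Y' = Λ(sM)`; p2 gen 16's `Rsw3.setToSetQuasiMultAspectAt_shift`), where `y` is chosen by pigeonhole among
`N = N(d,s,L)` centres whose balls `Λ_y(sM)` cover `∂ⁱⁿΛ(n)`, so that `P[0 ↔ ∂ⁱⁿΛ_y(sM) in Z] ≥ π(n)/N` (first entry of the arm from `0`);
the three one-arm factors are `≥ c/n²` (`TwoPointBoundedRatio.oneArmProb_lower`) and the right end is `τ_{p_c}(0,y) ≤ C n^{2-d}`: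
`ϰ²c³ n^{d-2} ≤ N·C·n⁶` for all large `M`, impossible when `d - 2 ≥ 7`.  (For `6 < d ≤ 8` beyond aspect `(2, L ≤ 4)` one would need
Aizenman 1997 Thm. 4 (2) in its large-aspect window form, not in the tree.)

(2) UNCONDITIONAL FORMS.  The Literature library proves (t-c) with `η = 0` and `ρ_ex = 1/2` for ALL SUFFICIENTLY LARGE `d` with no named
fact left (`twoPointBoundedRatio_eventually`, `rhoExHalf_eventually`: Hara–Slade 1990 + Hara 2008 + Kozma–Nachmias 2011, kernel).  Hence:
**`exists_forall_not_setToSetQuasiMultAt_criticalProbI : ∃ d₀, ∀ d ≥ d₀, ∀ ϰ > 0, ¬ SetToSetQuasiMultAt d (criticalProbI d) ϰ`**,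
**`exists_forall_not_setToSetQuasiMultAspectAt_criticalProbI`** (every aspect `(s, L)`, `s ≥ 1`) and
**`exists_forall_oneArmDoublingAt_criticalProbI : ∃ d₀, ∀ d ≥ d₀, ∃ c > 0, OneArmDoublingAt d (criticalProbI d) c`** — (A2)□ at criticality is
false, and one-arm doubling true, in every sufficiently high dimension, UNCONDITIONALLY in the kernel.

References: Basu–Sapozhnikov, ECP 22 (2017) no. 26, §1.2 third bullet [BasuSapozhnikov2017ECP]; Hara 2008 Thm. 1.1 [Hara2008];
Heydenreich–van der Hofstad (2017) Thms. 11.4/11.5 [HeydenreichVanDerHofstad2017]; Kozma–Nachmias 2011 Thm. 1 [KozmaNachmias2011].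
-/

noncomputable section

namespace Summit.CriticalPhenomena.PercolationContinuityZ3.Theorems.Crossing

open MeasureTheory Filter Topology
open Literature.Probability.Percolation Literature.Probability.LatticeModels
open Literature.Barriers.CriticalPhenomena
open Summit.CriticalPhenomena.PercolationContinuityZ3.Theorems.Rsw3

variable {d : ℕ}

/-! ## Rounding to a grid of mesh `h` -/

/-- Integer rounding to the grid `hℤ`: for `h = sM ≥ 1` and `|v| ≤ (L+s)M`, the multiple `q·h` with `q = v / h` (Euclidean division) is within
`h` of `v` and `|q| ≤ L + 2s`. [folklore] -/
theorem exists_grid_round {s L M : ℕ} (hs : 1 ≤ s) (hM : 1 ≤ M) (v : ℤ) (hv : |v| ≤ (((L + s) * M : ℕ) : ℤ)) :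
    ∃ q : ℤ, -((L + 2 * s : ℕ) : ℤ) ≤ q ∧ q ≤ ((L + 2 * s : ℕ) : ℤ) ∧
      -((s * M : ℕ) : ℤ) ≤ v - q * ((s * M : ℕ) : ℤ) ∧ v - q * ((s * M : ℕ) : ℤ) ≤ ((s * M : ℕ) : ℤ) := by
  set h : ℤ := ((s * M : ℕ) : ℤ) with hh
  have hs' : (1 : ℤ) ≤ s := by exact_mod_cast hs
  have hhsm : h = (s : ℤ) * M := by rw [hh]; push_cast; ring
  have hMh : (M : ℤ) ≤ h := by rw [hhsm]; nlinarith [(show (0 : ℤ) ≤ M by positivity)]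
  have h1 : h * (v / h) + v % h = v := Int.mul_ediv_add_emod v h
  have hr0 : 0 ≤ v % h := Int.emod_nonneg v (by omega)
  have hrh : v % h < h := Int.emod_lt_of_pos v (by omega)
  have hvr : v - v / h * h = v % h := by rw [mul_comm]; linarith
  rw [abs_le] at hv
  push_cast at hv
  have hQ : ((L + 2 * s : ℕ) : ℤ) = (L : ℤ) + 2 * s := by push_cast; ring
  refine ⟨v / h, ?_, ?_, by rw [hvr]; linarith, by rw [hvr]; exact hrh.le⟩
  · -- lower bound on the quotient
    by_contra hcon
    push Not at hcon
    have hq : v / h ≤ -((L : ℤ) + 2 * s) - 1 := by rw [hQ] at hcon; omega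
    have h3 : h * (v / h) ≤ h * (-((L : ℤ) + 2 * s) - 1) := mul_le_mul_of_nonneg_left hq (by omega)
    have h4 : h * (-((L : ℤ) + 2 * s) - 1) ≤ (M : ℤ) * (-((L : ℤ) + 2 * s) - 1) :=
      mul_le_mul_of_nonpos_right hMh (by nlinarith)
    have hMs : (0 : ℤ) ≤ (M : ℤ) * s := by positivity
    linarith
  · by_contra hcon
    push Not at hcon
    have hq : (L : ℤ) + 2 * s + 1 ≤ v / h := by rw [hQ] at hcon; omega
    have h3 : h * ((L : ℤ) + 2 * s + 1) ≤ h * (v / h) := mul_le_mul_of_nonneg_left hq (by omega)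
    have h4 : (M : ℤ) * ((L : ℤ) + 2 * s + 1) ≤ h * ((L : ℤ) + 2 * s + 1) :=
      mul_le_mul_of_nonneg_right hMh (by nlinarith)
    have hMs : (0 : ℤ) ≤ (M : ℤ) * s := by positivity
    linarith

/-! ## The covering centres at aspect `(s, L)` -/

/-- **Centres, general aspect.**  For `s, M ≥ 1` there is a set `C` of at most
`#(univ ×ˢ univ ×ˢ piFinset (Icc (-(L+2s)) (L+2s)))` sites `y`, each with some coordinate `= ±((L+s)M + 1)` and all coordinates of modulus
`≤ (L+2s)·sM + (L+s)M + 1`, whose balls `Λ_y(sM)` cover `∂ⁱⁿΛ((L+s)M)`. [folklore] -/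
theorem exists_highDim_centres_aspect (s L M : ℕ) (hs : 1 ≤ s) (hM : 1 ≤ M) :
    ∃ C : Finset (Site d),
      C.card ≤ ((Finset.univ : Finset (Fin d)) ×ˢ (Finset.univ : Finset Bool) ×ˢ
        Fintype.piFinset (fun _ : Fin d => Finset.Icc (-((L + 2 * s : ℕ) : ℤ)) ((L + 2 * s : ℕ) : ℤ))).card ∧
      (∀ y ∈ C, (∃ i, y i = (((L + s) * M + 1 : ℕ) : ℤ) ∨ y i = -(((L + s) * M + 1 : ℕ) : ℤ)) ∧
        ∀ i, |y i| ≤ (((L + 2 * s) * (s * M) + ((L + s) * M + 1) : ℕ) : ℤ)) ∧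
      ∀ t ∈ innerBoundary (zdGraph d) (box d ((L + s) * M)), ∃ y ∈ C, t ∈ GM.ball y (s * M) := by
  classical
  set Q : ℕ := L + 2 * s with hQ
  set D : ℕ := (L + s) * M + 1 with hD
  set I := (Finset.univ : Finset (Fin d)) ×ˢ (Finset.univ : Finset Bool) ×ˢ
    Fintype.piFinset (fun _ : Fin d => Finset.Icc (-(Q : ℤ)) (Q : ℤ)) with hI
  let F : Fin d × Bool × (Fin d → ℤ) → Site d := fun q i =>
    if i = q.1 then (if q.2.1 then (D : ℤ) else -(D : ℤ)) else q.2.2 i * ((s * M : ℕ) : ℤ)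
  have hsM0 : (0 : ℤ) ≤ ((s * M : ℕ) : ℤ) := by positivity
  refine ⟨I.image F, Finset.card_image_le, ?_, ?_⟩
  · intro y hy
    obtain ⟨q, hq, rfl⟩ := Finset.mem_image.1 hy
    rw [hI, Finset.mem_product, Finset.mem_product, Fintype.mem_piFinset] at hq
    obtain ⟨-, -, hg⟩ := hq
    have hD0 : (0 : ℤ) ≤ (D : ℤ) := by positivity
    have hP0 : (0 : ℤ) ≤ ((Q * (s * M) : ℕ) : ℤ) := by positivity
    have hB : (D : ℤ) ≤ ((Q * (s * M) + D : ℕ) : ℤ) := by push_cast at hP0 ⊢; linarith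
    refine ⟨⟨q.1, ?_⟩, fun i => ?_⟩
    · by_cases hb : q.2.1 <;> simp [F, hb]
    · by_cases hi : i = q.1
      · by_cases hb : q.2.1
        · simp only [F, hi, hb, if_true]; rwa [abs_of_nonneg hD0]
        · simp only [F, hi, hb, if_true, Bool.false_eq_true, if_false]; rwa [abs_neg, abs_of_nonneg hD0]
      · simp only [F, hi, if_false]
        have h1 := Finset.mem_Icc.1 (hg i)
        have h2 : |q.2.2 i * ((s * M : ℕ) : ℤ)| ≤ (Q : ℤ) * ((s * M : ℕ) : ℤ) := by
          rw [abs_mul, abs_of_nonneg hsM0]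
          exact mul_le_mul_of_nonneg_right (abs_le.2 ⟨h1.1, h1.2⟩) hsM0
        refine h2.trans ?_
        push_cast
        linarith
  · intro t ht
    obtain ⟨i₀, hi₀⟩ := exists_eq_of_mem_innerBoundary_box ht
    have htbox : ∀ i, -(((L + s) * M : ℕ) : ℤ) ≤ t i ∧ t i ≤ (((L + s) * M : ℕ) : ℤ) := fun i =>
      (mem_box.1 (mem_innerBoundary_iff.1 ht).1) i
    -- round the transverse coordinates
    have hround : ∀ i, ∃ q : ℤ, -(Q : ℤ) ≤ q ∧ q ≤ (Q : ℤ) ∧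
        -((s * M : ℕ) : ℤ) ≤ t i - q * ((s * M : ℕ) : ℤ) ∧ t i - q * ((s * M : ℕ) : ℤ) ≤ ((s * M : ℕ) : ℤ) := fun i =>
      exists_grid_round (L := L) hs hM (t i) (abs_le.2 (htbox i))
    choose g hg using hround
    have hgI : ∀ b : Bool, (i₀, b, g) ∈ I := fun b => by
      rw [hI, Finset.mem_product, Finset.mem_product, Fintype.mem_piFinset]
      exact ⟨Finset.mem_univ _, Finset.mem_univ _, fun i => Finset.mem_Icc.2 ⟨(hg i).1, (hg i).2.1⟩⟩
    have hsM1 : (1 : ℤ) ≤ ((s * M : ℕ) : ℤ) := by exact_mod_cast Nat.mul_le_mul hs hM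
    rcases hi₀ with h0 | h0
    · refine ⟨F (i₀, true, g), Finset.mem_image_of_mem F (hgI true), GM.mem_ball.2 fun i => ?_⟩
      by_cases hi : i = i₀
      · subst hi
        simp only [F, if_true]
        rw [h0, hD]; omega
      · simp only [F, hi, if_false]
        exact ⟨(hg i).2.2.1, (hg i).2.2.2⟩
    · refine ⟨F (i₀, false, g), Finset.mem_image_of_mem F (hgI false), GM.mem_ball.2 fun i => ?_⟩
      by_cases hi : i = i₀
      · subst hi
        simp only [F, if_true, Bool.false_eq_true, if_false]
        rw [h0, hD]; omega
      · simp only [F, hi, if_false]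
        exact ⟨(hg i).2.2.1, (hg i).2.2.2⟩

/-! ## The refutation at every aspect, `d > 8` -/

/-- **(A2)□ fails at `p_c(ℤ^d)` at EVERY aspect `(s, L)`, `s ≥ 1`, when `d > 8` and (t-c) with `η = 0` holds.**  For `8 < d`,
`TwoPointBoundedRatio d`, `1 ≤ s`, any `L` and `ϰ > 0`: `¬ SetToSetQuasiMultAspectAt d (criticalProbI d) s L ϰ`.  All-polynomial argument
(three one-arm factors `≥ c/n²`, `n = (L+s)M`, against `τ_{p_c}(0,y) ≤ C n^{2-d}`; no annulus-crossing input), see the file header.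
[cite: BasuSapozhnikov2017ECP, §1 assumption (A2) and §1.2] [cite: HeydenreichVanDerHofstad2017, Thm. 11.5 (11.3.2) and Exercise 11.9] -/
theorem not_setToSetQuasiMultAspectAt_criticalProbI_of_twoPointBoundedRatio (hd : 8 < d) (hτ : TwoPointBoundedRatio d)
    {s : ℕ} (hs : 1 ≤ s) (L : ℕ) {ϰ : ℝ} (hϰ : 0 < ϰ) : ¬ SetToSetQuasiMultAspectAt d (criticalProbI d) s L ϰ := by
  classical
  intro hA2
  haveI : NeZero d := ⟨by omega⟩
  set p := criticalProbI d with hp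
  set μ := bondPercolation (zdGraph d) p with hμ
  obtain ⟨C', C, hC', hC'C, hb⟩ := hτ.natPow (by omega)
  have hC : 0 < C := hC'.trans_le hC'C
  obtain ⟨c, hc, hπ⟩ := hτ.oneArmProb_lower (by omega)
  -- the number of centres (depends on `d, s, L` only)
  set I := (Finset.univ : Finset (Fin d)) ×ˢ (Finset.univ : Finset Bool) ×ˢ
    Fintype.piFinset (fun _ : Fin d => Finset.Icc (-((L + 2 * s : ℕ) : ℤ)) ((L + 2 * s : ℕ) : ℤ)) with hI
  set N : ℕ := I.card with hN
  have hN0 : 0 < (N : ℝ) := by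
    have : I.Nonempty := ⟨(⟨0, by omega⟩, true, fun _ => 0), by
      rw [hI, Finset.mem_product, Finset.mem_product, Fintype.mem_piFinset]
      refine ⟨Finset.mem_univ _, Finset.mem_univ _, fun _ => Finset.mem_Icc.2 ⟨?_, ?_⟩⟩
      · exact neg_nonpos.2 (Nat.cast_nonneg _)
      · exact Nat.cast_nonneg _⟩
    rw [hN]; exact_mod_cast this.card_pos
  -- the constant and the scale
  set A : ℝ := ϰ ^ 2 * c ^ 3 / N with hA
  have hA0 : 0 < A := by rw [hA]; positivity
  obtain ⟨M, hM1, hMA⟩ : ∃ M : ℕ, 1 ≤ M ∧ C < A * M := by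
    obtain ⟨K, hK⟩ := exists_nat_gt (C / A)
    refine ⟨max 1 K, le_max_left _ _, ?_⟩
    have h1 : C / A < ((max 1 K : ℕ) : ℝ) := hK.trans_le (by exact_mod_cast le_max_right _ _)
    rwa [div_lt_iff₀ hA0, mul_comm] at h1
  -- abbreviations: a = sM, b = LM, n = b + a, e = transverse bound
  set a : ℕ := s * M with ha
  set b : ℕ := L * M with hbM
  have ha1 : 1 ≤ a := by rw [ha]; exact Nat.mul_le_mul hs hM1
  have hMa : M ≤ a := by rw [ha]; exact Nat.le_mul_of_pos_left M (by omega)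
  have hLs : (L + s) * M = b + a := by rw [ha, hbM]; ring
  set e : ℕ := (L + 2 * s) * a with he
  set R : ℕ := (b + a + 1) + e + b + a with hR
  set Z : Finset (Site d) := box d R with hZ
  have hboxZ : ∀ {r : ℕ}, r ≤ R → box d r ⊆ Z := fun hr => by rw [hZ]; exact box_mono d hr
  -- centres
  obtain ⟨Cs, hCs, hgood, hcover⟩ := exists_highDim_centres_aspect (d := d) s L M hs hM1
  rw [hLs] at hgood hcover
  have hCsN : Cs.card ≤ N := by rw [hN, hI]; exact hCs
  -- geometry of the centres
  have hy_i : ∀ y ∈ Cs, ∃ i, y i = ((b + a + 1 : ℕ) : ℤ) ∨ y i = -((b + a + 1 : ℕ) : ℤ) := fun y hy => (hgood y hy).1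
  have hy_abs : ∀ y ∈ Cs, ∀ i, |y i| ≤ ((e + (b + a + 1) : ℕ) : ℤ) := fun y hy i => by
    have := (hgood y hy).2 i; rw [he, ha]; push_cast at this ⊢; nlinarith [this]
  have hy_out : ∀ y ∈ Cs, ∀ z ∈ GM.ball y b, z ∉ box d a := by
    intro y hy z hz hz'
    obtain ⟨i, hi⟩ := hy_i y hy
    have h1 := (GM.mem_ball.1 hz) i
    have h2 := (mem_box.1 hz') i
    push_cast at h1 h2 hi
    rcases hi with hi | hi <;> rw [hi] at h1 <;> omega
  have hy_Zr : ∀ y ∈ Cs, ∀ r : ℕ, r ≤ b + a → GM.ball y r ⊆ Z := by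
    intro y hy r hr z hz
    rw [hZ, mem_box]
    intro i
    have h1 := (GM.mem_ball.1 hz) i
    have h2 := hy_abs y hy i
    rw [abs_le] at h2
    push_cast at h1 h2 ⊢
    constructor <;> omega
  have hy_notbox : ∀ y ∈ Cs, y ∉ box d (b + a) := by
    intro y hy hy'
    obtain ⟨i, hi⟩ := hy_i y hy
    have h2 := (mem_box.1 hy') i
    push_cast at h2 hi
    rcases hi with hi | hi <;> rw [hi] at h2 <;> omega
  have hy_zero : ∀ y ∈ Cs, (0 : Site d) ∉ GM.ball y a := by
    intro y hy h0
    obtain ⟨i, hi⟩ := hy_i y hy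
    have h1 := (GM.mem_ball.1 h0) i
    simp only [Pi.zero_apply, zero_sub] at h1
    push_cast at h1 hi
    rcases hi with hi | hi <;> rw [hi] at h1 <;> omega
  -- the events `E y = {0 ↔ ∂ⁱⁿΛ_y(a) in Z}` and the covering of the arm from `0`
  set E : Site d → Set (BondConfig (Site d)) := fun y =>
    openCrossing (↑Z : Set (Site d)) ↑(GM.ball (0 : Site d) 0) ↑(innerBoundary (zdGraph d) (GM.ball y a)) with hE
  have hcov : oneArmProb d p (b + a) ≤ μ.real (⋃ y ∈ Cs, E y) := by
    refine DCT16.real_mono_of_forall_subset_edgeSet (zdGraph d) p fun ω hω hmem => ?_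
    obtain ⟨t, ht, h0t⟩ := hmem
    obtain ⟨y, hy, hty⟩ := hcover t ht
    refine Set.mem_biUnion (Finset.mem_coe.2 hy) ?_
    have h0t' : ω ∈ openConnIn (↑Z : Set (Site d)) 0 t := openConnIn_mono (Finset.coe_subset.2 (hboxZ (by omega))) 0 t h0t
    have hmem' : ω ∈ openCrossing (↑Z : Set (Site d)) ↑(GM.ball t 0) ↑(GM.ball (0 : Site d) 0) :=
      ⟨t, Finset.mem_coe.2 (GM.self_mem_ball t 0), 0, Finset.mem_coe.2 (GM.self_mem_ball 0 0), GM.openConnIn_comm.1 h0t'⟩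
    have hsub : GM.ball t 0 ⊆ GM.ball y a := fun z hz => by rw [mem_gmBall_zero_iff.1 hz]; exact hty
    have hY' : ∀ z ∈ GM.ball (0 : Site d) 0, z ∉ GM.ball y a := fun z hz => by
      rw [mem_gmBall_zero_iff.1 hz]; exact hy_zero y hy
    exact mem_openCrossing_innerBoundary_of_mem_openCrossing_ball hsub hY' hω hmem'
  -- pigeonhole
  have hsum : c / ((b + a : ℕ) : ℝ) ^ 2 ≤ ∑ y ∈ Cs, μ.real (E y) :=
    calc c / ((b + a : ℕ) : ℝ) ^ 2 ≤ oneArmProb d p (b + a) := hπ (b + a) (by omega)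
      _ ≤ μ.real (⋃ y ∈ Cs, E y) := hcov
      _ ≤ ∑ y ∈ Cs, μ.real (E y) := measureReal_biUnion_finset_le Cs E
  have hn0 : (0 : ℝ) < ((b + a : ℕ) : ℝ) := by exact_mod_cast (show 0 < b + a by omega)
  have hCsne : Cs.Nonempty := by
    by_contra h
    rw [Finset.not_nonempty_iff_eq_empty.1 h, Finset.sum_empty] at hsum
    have : 0 < c / ((b + a : ℕ) : ℝ) ^ 2 := by positivity
    linarith
  obtain ⟨y, hy, hEy⟩ : ∃ y ∈ Cs, c / ((b + a : ℕ) : ℝ) ^ 2 / N ≤ μ.real (E y) := by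
    by_contra hcon
    push Not at hcon
    have hlt : ∑ y ∈ Cs, μ.real (E y) < ∑ y ∈ Cs, c / ((b + a : ℕ) : ℝ) ^ 2 / N :=
      Finset.sum_lt_sum_of_nonempty hCsne fun y hy => hcon y hy
    rw [Finset.sum_const, nsmul_eq_mul] at hlt
    have : (Cs.card : ℝ) * (c / ((b + a : ℕ) : ℝ) ^ 2 / N) ≤ N * (c / ((b + a : ℕ) : ℝ) ^ 2 / N) :=
      mul_le_mul_of_nonneg_right (by exact_mod_cast hCsN) (by positivity)
    have hNN : (N : ℝ) * (c / ((b + a : ℕ) : ℝ) ^ 2 / N) = c / ((b + a : ℕ) : ℝ) ^ 2 := by field_simp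
    linarith
  -- application (2): centred at `y`, scale `M`, `X' = Λ_y(0)`, `Y' = Λ(a)`
  have hyZb : GM.ball y (L * M) ⊆ Z := hy_Zr y hy b (by omega)
  have hX2 : GM.ball y 0 ⊆ Z ∩ GM.ball y M :=
    Finset.subset_inter ((ball_subset_ball_of_le y (Nat.zero_le _)).trans (hy_Zr y hy M (by omega)))
      (ball_subset_ball_of_le y (Nat.zero_le _))
  have hY2 : box d (s * M) ⊆ Z \ GM.ball y (L * M) := fun z hz =>
    Finset.mem_sdiff.2 ⟨hboxZ (by omega) hz, fun hz' => hy_out y hy z hz' hz⟩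
  have h2 := setToSetQuasiMultAspectAt_shift hA2 y hM1 Z (Finset.sdiff_subset.trans hyZb) (GM.ball y 0) hX2
    (box d (s * M)) hY2
  have h2a : oneArmProb d p a ≤
      μ.real (openCrossing (↑Z : Set (Site d)) ↑(GM.ball y 0) ↑(innerBoundary (zdGraph d) (GM.ball y (s * M)))) :=
    oneArmProb_le_real_openCrossing_ball p y a Z (hy_Zr y hy a (by omega))
  have h2b : μ.real (E y) ≤ μ.real (openCrossing (↑Z : Set (Site d)) ↑(box d (s * M))
      ↑(innerBoundary (zdGraph d) (GM.ball y (s * M)))) := by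
    refine measureReal_mono (openCrossing_mono le_rfl ?_ le_rfl)
    rw [GM.ball_zero]; exact Finset.coe_subset.2 (box_mono d (Nat.zero_le _))
  have h2c : μ.real (openCrossing (↑Z : Set (Site d)) ↑(GM.ball y 0) ↑(box d (s * M))) ≤
      μ.real (openCrossing (↑Z : Set (Site d)) ↑(GM.ball y 0) ↑(innerBoundary (zdGraph d) (box d (s * M)))) := by
    refine DCT16.real_mono_of_forall_subset_edgeSet (zdGraph d) p fun ω hω hmem => ?_
    obtain ⟨u, hu, v, hv, huv⟩ := hmem
    have hY' : ∀ z ∈ GM.ball y 0, z ∉ GM.ball (0 : Site d) (s * M) := fun z hz => by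
      rw [mem_gmBall_zero_iff.1 hz, GM.ball_zero]; exact hy_out y hy y (GM.self_mem_ball y _)
    have hmem' : ω ∈ openCrossing (↑Z : Set (Site d)) ↑(GM.ball (0 : Site d) (s * M)) ↑(GM.ball y 0) :=
      ⟨v, by rw [GM.ball_zero]; exact hv, u, hu, GM.openConnIn_comm.1 huv⟩
    have h := mem_openCrossing_innerBoundary_of_mem_openCrossing_ball le_rfl hY' hω hmem'
    rwa [GM.ball_zero] at h
  -- application (1): at the origin, scale `M`, `X = Λ_0(0)`, `Y = Λ_y(0)`
  have hymemZ : y ∈ Z := hy_Zr y hy 0 (Nat.zero_le _) (GM.self_mem_ball y 0)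
  have hX1 : GM.ball (0 : Site d) 0 ⊆ Z ∩ GM.ball (0 : Site d) M := by
    rw [GM.ball_zero, GM.ball_zero]
    exact Finset.subset_inter (hboxZ (by omega)) (box_mono d (Nat.zero_le _))
  have hY1 : GM.ball y 0 ⊆ Z \ GM.ball (0 : Site d) (L * M) := fun z hz => by
    rw [mem_gmBall_zero_iff.1 hz, GM.ball_zero]
    exact Finset.mem_sdiff.2 ⟨hymemZ, fun h' => hy_notbox y hy (box_mono d (by omega) h')⟩
  have hZ1 : GM.ball (0 : Site d) (L * M) \ GM.ball (0 : Site d) (M - 1) ⊆ Z := by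
    rw [GM.ball_zero, GM.ball_zero]
    exact Finset.sdiff_subset.trans (hboxZ (by omega))
  have h1 := setToSetQuasiMultAspectAt_shift hA2 (0 : Site d) hM1 Z hZ1 (GM.ball 0 0) hX1 (GM.ball y 0) hY1
  have h1a : oneArmProb d p a ≤
      μ.real (openCrossing (↑Z : Set (Site d)) ↑(GM.ball (0 : Site d) 0)
        ↑(innerBoundary (zdGraph d) (GM.ball (0 : Site d) (s * M)))) :=
    oneArmProb_le_real_openCrossing_ball p 0 a Z (by rw [GM.ball_zero]; exact hboxZ (by omega))
  have h1c : μ.real (openCrossing (↑Z : Set (Site d)) ↑(GM.ball (0 : Site d) 0) ↑(GM.ball y 0)) ≤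
      C * ((((b + a : ℕ) : ℝ)) ^ (d - 2))⁻¹ := by
    have hy0 : (0 : Site d) ≠ y := by
      intro h; exact hy_notbox y hy (h ▸ zero_mem_box d _)
    calc μ.real (openCrossing (↑Z : Set (Site d)) ↑(GM.ball (0 : Site d) 0) ↑(GM.ball y 0))
        ≤ μ.real (openConn (0 : Site d) y) := measureReal_mono (openCrossing_ball_zero_subset_openConn Z 0 y)
      _ = tau d p 0 y := rfl
      _ ≤ C * (‖(0 : Site d) - y‖ ^ (d - 2))⁻¹ := (hb 0 y hy0).2
      _ ≤ C * (((b + a : ℕ) : ℝ) ^ (d - 2))⁻¹ := by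
          refine mul_le_mul_of_nonneg_left ?_ hC.le
          have hnorm : ((b + a : ℕ) : ℝ) < ‖(0 : Site d) - y‖ := by
            rw [zero_sub, norm_neg]; exact lt_norm_of_not_mem_box (hy_notbox y hy)
          exact inv_anti₀ (by positivity) (pow_le_pow_left₀ (by positivity) hnorm.le _)
  simp only [GM.ball_zero] at h1 h1a h1c h2a
  -- assemble
  have hπa : c / ((b + a : ℕ) : ℝ) ^ 2 ≤ oneArmProb d p a := by
    refine le_trans ?_ (hπ a ha1)
    exact div_le_div_of_nonneg_left hc.le (by positivity)
      (pow_le_pow_left₀ (by positivity) (by exact_mod_cast (show a ≤ b + a by omega)) 2)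
  have hB : ϰ * (c / ((b + a : ℕ) : ℝ) ^ 2 * (c / ((b + a : ℕ) : ℝ) ^ 2 / N)) ≤
      μ.real (openCrossing (↑Z : Set (Site d)) ↑(GM.ball y 0) ↑(innerBoundary (zdGraph d) (box d (s * M)))) := by
    refine le_trans ?_ (h2.trans h2c)
    refine mul_le_mul_of_nonneg_left ?_ hϰ.le
    exact mul_le_mul (hπa.trans h2a) (hEy.trans h2b) (by positivity) measureReal_nonneg
  have hmain : ϰ * (c / ((b + a : ℕ) : ℝ) ^ 2 * (ϰ * (c / ((b + a : ℕ) : ℝ) ^ 2 * (c / ((b + a : ℕ) : ℝ) ^ 2 / N)))) ≤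
      C * (((b + a : ℕ) : ℝ) ^ (d - 2))⁻¹ := by
    refine le_trans ?_ (h1.trans h1c)
    refine mul_le_mul_of_nonneg_left ?_ hϰ.le
    exact mul_le_mul (hπa.trans h1a) hB (by positivity) measureReal_nonneg
  -- arithmetic with `n = b + a ≥ M`
  set n : ℝ := ((b + a : ℕ) : ℝ) with hn
  have hn1 : (1 : ℝ) ≤ n := by rw [hn]; exact_mod_cast (show 1 ≤ b + a by omega)
  have hnM : (M : ℝ) ≤ n := by rw [hn]; exact_mod_cast (show M ≤ b + a by omega)
  have hL : ϰ * (c / n ^ 2 * (ϰ * (c / n ^ 2 * (c / n ^ 2 / N)))) = A / n ^ 6 := by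
    rw [hA]
    field_simp
    try ring
  have hR : C * (n ^ (d - 2))⁻¹ ≤ C / n ^ 7 := by
    rw [div_eq_mul_inv]
    exact mul_le_mul_of_nonneg_left (inv_anti₀ (by positivity) (pow_le_pow_right₀ hn1 (by omega))) hC.le
  have hfin : A / n ^ 6 ≤ C / n ^ 7 := by rw [← hL]; exact hmain.trans hR
  rw [div_le_div_iff₀ (by positivity) (by positivity)] at hfin
  have h6 : (0 : ℝ) < n ^ 6 := by positivity
  have h7 : A * n * n ^ 6 ≤ C * n ^ 6 := by rw [show A * n * n ^ 6 = A * n ^ 7 by ring]; exact hfin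
  have hAn : A * n ≤ C := le_of_mul_le_mul_right h7 h6
  have hAM : A * (M : ℝ) ≤ A * n := mul_le_mul_of_nonneg_left hnM hA0.le
  linarith

/-- **(A2)□ fails at `p_c(ℤ^d)` at every aspect `(s, L)`, `s ≥ 1`, for every `d ≥ 11`**, granted the named fact `Hara2008_etaZeroXSpace`.
[cite: HeydenreichVanDerHofstad2017, Thm. 11.4] [cite: BasuSapozhnikov2017ECP, §1 assumption (A2)] -/
theorem not_setToSetQuasiMultAspectAt_criticalProbI_of_hara (hH : Hara2008_etaZeroXSpace) (hd : 11 ≤ d) {s : ℕ} (hs : 1 ≤ s)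
    (L : ℕ) {ϰ : ℝ} (hϰ : 0 < ϰ) : ¬ SetToSetQuasiMultAspectAt d (criticalProbI d) s L ϰ :=
  not_setToSetQuasiMultAspectAt_criticalProbI_of_twoPointBoundedRatio (by omega) (hH.twoPointBoundedRatio hd) hs L hϰ

/-! ## Unconditional forms for all sufficiently large `d` -/

/-- **(A2)□ FAILS AT CRITICALITY IN EVERY SUFFICIENTLY HIGH DIMENSION — UNCONDITIONAL.**  There is `d₀` such that for every `d ≥ d₀`
and every `ϰ > 0`, `¬ SetToSetQuasiMultAt d (criticalProbI d) ϰ`: V149's `d > 6` theorem composed with the Literature library's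
hypothesis-free `twoPointBoundedRatio_eventually` (Hara–Slade 1990 + Hara 2008, kernel).  No named fact.
[cite: BasuSapozhnikov2017ECP, §1.2 (third bullet)] [cite: Hara2008, Thm. 1.1] -/
theorem exists_forall_not_setToSetQuasiMultAt_criticalProbI :
    ∃ d₀ : ℕ, ∀ d : ℕ, d₀ ≤ d → ∀ ϰ : ℝ, 0 < ϰ → ¬ SetToSetQuasiMultAt d (criticalProbI d) ϰ := by
  obtain ⟨d₀, h6, h⟩ := twoPointBoundedRatio_eventually
  exact ⟨d₀, fun d hd ϰ hϰ => not_setToSetQuasiMultAt_criticalProbI_of_twoPointBoundedRatio (by omega) (h d hd) hϰ⟩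

/-- **The same at every aspect `(s, L)`, `s ≥ 1` — UNCONDITIONAL for all sufficiently large `d`.**
[cite: BasuSapozhnikov2017ECP, §1 assumption (A2)] [cite: Hara2008, Thm. 1.1] -/
theorem exists_forall_not_setToSetQuasiMultAspectAt_criticalProbI :
    ∃ d₀ : ℕ, ∀ d : ℕ, d₀ ≤ d → ∀ s L : ℕ, 1 ≤ s → ∀ ϰ : ℝ, 0 < ϰ →
      ¬ SetToSetQuasiMultAspectAt d (criticalProbI d) s L ϰ := by
  obtain ⟨d₀, h6, h⟩ := twoPointBoundedRatio_eventually
  refine ⟨max d₀ 9, fun d hd s L hs ϰ hϰ => ?_⟩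
  exact not_setToSetQuasiMultAspectAt_criticalProbI_of_twoPointBoundedRatio (lt_of_lt_of_le (by norm_num) ((le_max_right _ _).trans hd))
    (h d ((le_max_left _ _).trans hd)) hs L hϰ

/-- **One-arm doubling holds at `p_c(ℤ^d)` in every sufficiently high dimension — UNCONDITIONAL** (`rhoExHalf_eventually`: Kozma–Nachmias
2011 Thm. 1 for all large `d`, kernel).  So in high dimensions the lane's (S2′) holds while (A2)□ fails.
[cite: KozmaNachmias2011, Thm. 1] [cite: KozmaNitzan2024, Conj. 1 (p. 3)] -/
theorem exists_forall_oneArmDoublingAt_criticalProbI :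
    ∃ d₀ : ℕ, ∀ d : ℕ, d₀ ≤ d → ∃ c : ℝ, 0 < c ∧ OneArmDoublingAt d (criticalProbI d) c := by
  obtain ⟨d₀, -, h⟩ := rhoExHalf_eventually
  exact ⟨d₀, fun d hd => exists_oneArmDoublingAt_criticalProbI_of_rhoExHalf (h d hd)⟩

end Summit.CriticalPhenomena.PercolationContinuityZ3.Theorems.Crossing
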